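import Mathlib.Tactic.Linarith
import Mathlib.Tactic.Positivity
import Mathlib.Tactic.Ring
import Summits.CriticalPhenomena.SAWScalingLimit.Theorems.SAWTotalPositivityBoundaryTP2Defs
import Summits.CriticalPhenomena.SAWScalingLimit.Theorems.EdgeOfPositivity.Negative.EdgeOfPositivityRectDomain
import HarnessLib

/-!
# Crux `BoundaryTP2` (stmt-CriticalPhenomena-7115), line `Sketch`: even sector of the strip-3 transfer

Stub `stub_strip3_evenSigns` (A2) of the 3-row strip programme — pure real arithmetic, no graph theory.

The even sector of the last-column transfer recursion of the strip `{0..L} × {0,1,2}` is the matrix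
`T_e = [[x+x³, 2x², x⁴],[x², x, 0],[x², 0, x³]]` acting on the two trajectories `u_L = (S,b,Q)_L`
(start `(1+x², x, x)`) and `w_L = (B,e,P)_L` (start `(2x, 1, 0)`).  For `0 ≤ x ≤ 1`:

* all six sequences stay non-negative (`T_e` is entrywise non-negative, and so are the initial vectors);
* the three `2×2` minors of `[u_L | w_L]`, `m₀₁ = S e − b B`, `m₀₂ = S P − Q B`, `m₁₂ = b P − Q e`,
  evolve linearly by the second compound `Λ²T_e = [[x²−x⁴, −x⁶, −x⁵],[−2x⁴, x⁴, 2x⁵],[−x³, x⁵, x⁴]]`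
  (Cauchy–Binet; three polynomial identities checked by `ring`), which preserves the sign pattern
  `(+,−,−)` of `m⃗₀ = (1−x², −2x², −x)` because `x² − x⁴ = x²(1−x²) ≥ 0` on `[0,1]`.
-/

noncomputable section

namespace Summit.CriticalPhenomena.SAWScalingLimit.Theorems.BoundaryTP2

open Literature.Probability.LatticeModels Literature.Probability.RandomPlanarGeometry
open Summit.CriticalPhenomena.SAWScalingLimit.Theorems.EdgeOfPositivity.Negative
open scoped ENNReal

/-- Cauchy–Binet for the `(0,1)` minor of `[T_e u | T_e w]`: the first row of `Λ²T_e`,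
`m₀₁' = (x²−x⁴) m₀₁ − x⁶ m₀₂ − x⁵ m₁₂`. [folklore] -/
private theorem s3even_compound01 (x S b Q B e P : ℝ) :
    ((x + x ^ 3) * S + 2 * x ^ 2 * b + x ^ 4 * Q) * (x ^ 2 * B + x * e) -
        (x ^ 2 * S + x * b) * ((x + x ^ 3) * B + 2 * x ^ 2 * e + x ^ 4 * P) =
      (x ^ 2 - x ^ 4) * (S * e - b * B) - x ^ 6 * (S * P - Q * B) - x ^ 5 * (b * P - Q * e) := by
  ring

/-- Cauchy–Binet for the `(0,2)` minor of `[T_e u | T_e w]`: the second row of `Λ²T_e`,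
`m₀₂' = −2x⁴ m₀₁ + x⁴ m₀₂ + 2x⁵ m₁₂`. [folklore] -/
private theorem s3even_compound02 (x S b Q B e P : ℝ) :
    ((x + x ^ 3) * S + 2 * x ^ 2 * b + x ^ 4 * Q) * (x ^ 2 * B + x ^ 3 * P) -
        (x ^ 2 * S + x ^ 3 * Q) * ((x + x ^ 3) * B + 2 * x ^ 2 * e + x ^ 4 * P) =
      -(2 * x ^ 4) * (S * e - b * B) + x ^ 4 * (S * P - Q * B) + 2 * x ^ 5 * (b * P - Q * e) := by
  ring

/-- Cauchy–Binet for the `(1,2)` minor of `[T_e u | T_e w]`: the third row of `Λ²T_e`,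
`m₁₂' = −x³ m₀₁ + x⁵ m₀₂ + x⁴ m₁₂`. [folklore] -/
private theorem s3even_compound12 (x S b Q B e P : ℝ) :
    (x ^ 2 * S + x * b) * (x ^ 2 * B + x ^ 3 * P) - (x ^ 2 * S + x ^ 3 * Q) * (x ^ 2 * B + x * e) =
      -x ^ 3 * (S * e - b * B) + x ^ 5 * (S * P - Q * B) + x ^ 4 * (b * P - Q * e) := by
  ring

/-- STUB A2 (`stub_strip3_evenSigns`). The even sector: both trajectories `u = (S,b,Q)` from
`(1+x², x, x)` and `w = (B,e,P)` from `(2x, 1, 0)` of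
`T_e = [[x+x³, 2x², x⁴],[x², x, 0],[x², 0, x³]]` stay non-negative, and the three 2×2 minors of the
matrix `[u | w]` keep the signs `(+,-,-)`: their vector is driven by the second compound
`Λ²T_e = [[x²-x⁴, -x⁶, -x⁵],[-2x⁴, x⁴, 2x⁵],[-x³, x⁵, x⁴]]`, which preserves that sign pattern for
`0 ≤ x ≤ 1`. The first sign is `S e ≥ b B (= 2b²)`, i.e. the facing minor `ae ≥ b²` up to `D ≥ 0`.
Proof: one induction on `L` carrying the nine facts; the step rewrites the `(L+1)`-values by the
recursion, closes non-negativity by `positivity`, and the three minor inequalities by the compound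
identities `s3even_compound01/02/12` plus the signs of the coefficients. [folklore] -/
theorem stub_strip3_evenSigns {x : ℝ} (hx0 : 0 ≤ x) (hx1 : x ≤ 1) (S b Q B e P : ℕ → ℝ)
    (hS0 : S 0 = 1 + x ^ 2) (hb0 : b 0 = x) (hQ0 : Q 0 = x) (hB0 : B 0 = 2 * x) (he0 : e 0 = 1)
    (hP0 : P 0 = 0)
    (hS : ∀ L, S (L + 1) = (x + x ^ 3) * S L + 2 * x ^ 2 * b L + x ^ 4 * Q L)
    (hb : ∀ L, b (L + 1) = x ^ 2 * S L + x * b L)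
    (hQ : ∀ L, Q (L + 1) = x ^ 2 * S L + x ^ 3 * Q L)
    (hB : ∀ L, B (L + 1) = (x + x ^ 3) * B L + 2 * x ^ 2 * e L + x ^ 4 * P L)
    (he : ∀ L, e (L + 1) = x ^ 2 * B L + x * e L)
    (hP : ∀ L, P (L + 1) = x ^ 2 * B L + x ^ 3 * P L) :
    ∀ L, (0 ≤ S L ∧ 0 ≤ b L ∧ 0 ≤ Q L ∧ 0 ≤ B L ∧ 0 ≤ e L ∧ 0 ≤ P L) ∧
      b L * B L ≤ S L * e L ∧ S L * P L ≤ Q L * B L ∧ b L * P L ≤ Q L * e L := by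
  intro L
  induction L with
  | zero =>
    rw [hS0, hb0, hQ0, hB0, he0, hP0]
    refine ⟨⟨by positivity, hx0, hx0, by positivity, zero_le_one, le_rfl⟩, ?_, ?_, ?_⟩
    · nlinarith [mul_nonneg hx0 (sub_nonneg.2 hx1)]
    · nlinarith [mul_nonneg hx0 hx0]
    · nlinarith
  | succ L ih =>
    obtain ⟨⟨hSn, hbn, hQn, hBn, hen, hPn⟩, h01, h02, h12⟩ := ih
    -- signs of the old minors, written without subtraction in `ih`
    have m01 : 0 ≤ S L * e L - b L * B L := sub_nonneg.2 h01
    have m02 : 0 ≤ Q L * B L - S L * P L := sub_nonneg.2 h02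
    have m12 : 0 ≤ Q L * e L - b L * P L := sub_nonneg.2 h12
    -- signs of the coefficients of `Λ²T_e` on `[0,1]`
    have h1x : 0 ≤ 1 - x ^ 2 := by nlinarith [mul_nonneg hx0 (sub_nonneg.2 hx1)]
    have hx2 : (0 : ℝ) ≤ x ^ 2 := by positivity
    have hx3 : (0 : ℝ) ≤ x ^ 3 := by positivity
    have hx4 : (0 : ℝ) ≤ x ^ 4 := by positivity
    have hx5 : (0 : ℝ) ≤ x ^ 5 := by positivity
    have hx6 : (0 : ℝ) ≤ x ^ 6 := by positivity
    rw [hS, hb, hQ, hB, he, hP]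
    refine ⟨⟨?_, ?_, ?_, ?_, ?_, ?_⟩, ?_, ?_, ?_⟩
    · positivity
    · positivity
    · positivity
    · positivity
    · positivity
    · positivity
    · -- `m₀₁' = x²(1-x²) m₀₁ + x⁶ (−m₀₂) + x⁵ (−m₁₂) ≥ 0`
      nlinarith [s3even_compound01 x (S L) (b L) (Q L) (B L) (e L) (P L),
        mul_nonneg (mul_nonneg hx2 h1x) m01, mul_nonneg hx6 m02, mul_nonneg hx5 m12]
    · -- `−m₀₂' = 2x⁴ m₀₁ + x⁴ (−m₀₂) + 2x⁵ (−m₁₂) ≥ 0`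
      nlinarith [s3even_compound02 x (S L) (b L) (Q L) (B L) (e L) (P L),
        mul_nonneg hx4 m01, mul_nonneg hx4 m02, mul_nonneg hx5 m12]
    · -- `−m₁₂' = x³ m₀₁ + x⁵ (−m₀₂) + x⁴ (−m₁₂) ≥ 0`
      nlinarith [s3even_compound12 x (S L) (b L) (Q L) (B L) (e L) (P L),
        mul_nonneg hx3 m01, mul_nonneg hx5 m02, mul_nonneg hx4 m12]

end Summit.CriticalPhenomena.SAWScalingLimit.Theorems.BoundaryTP2
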